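import Summits.BirchSwinnertonDyer.BirchSwinnertonDyer.Theorems.TeichmullerTwistDescentCellsOfKato
import HarnessLib

/-!
# Route `TeichmullerTwistDescent` — aside item `ManinSideOfPubBundles` (stmt-BirchSwinnertonDyer-25548) by name

BOOKKEEPING ONLY (the planner's TURNKEY twin, director W-77 Option A, «never counted as progress»): the item records
that the route's seven Manin-side declarations (PSMU, SCMU57, CORNER, LOW5, WILD, TAME, GE11) follow from the two
REGISTERED hypothesis bundles `KatoNeronAndCremonaFacts` (F″ = Kato–Néron integrality, cite-only) and
`PublishedInputsAdditiveKoly` (modularity, cite-only) alone. The mathematics is the already-landed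
`maninSide_of_pubBundles` (`TeichmullerTwistDescentCellsOfKato.lean`, p596449, seat bsd-line-ttd-p2); this file only
states it at the item's declaration so the gate can close the twin by name. CONDITIONAL on the two bundles by the
item's own shape; the live Manin items stay open; BSD is not proved by this and no W-ALL class theorem is proved.
-/

-- D-0017: single-problem summit, so `Summit.BirchSwinnertonDyer.BirchSwinnertonDyer.…` repeats a namespace BY DESIGN.
set_option linter.dupNamespace false
set_option autoImplicit false

open Summit.BirchSwinnertonDyer.BirchSwinnertonDyer.Theses.TeichmullerTwistDescent

namespace Summit.BirchSwinnertonDyer.BirchSwinnertonDyer.Theorems.TeichmullerTwistDescent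

/-- **Item stmt-BirchSwinnertonDyer-25548 by name** (`ManinSideOfPubBundles`, aside twin): the seven Manin-side
declarations of the route from the two registered bundles only — a restatement of `maninSide_of_pubBundles` at the
item's declaration. [cite: Kato2004Asterisque, (8.1.3) (p. 180), Thm. 9.7 (p. 189)] -/
theorem maninSideOfPubBundles_proof : ManinSideOfPubBundles := by
  unfold ManinSideOfPubBundles
  intro hKC hP
  exact maninSide_of_pubBundles hKC hP

end Summit.BirchSwinnertonDyer.BirchSwinnertonDyer.Theorems.TeichmullerTwistDescent
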